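import Mathlib

/-! # Pair field sign criterion (lens-1 I1, stub `pairField_im_pos_iff`)

The conjugate pair {c, c̄} pushes the field at v UPWARD iff v lies STRICTLY INSIDE the pair's Jensen disc.
This is the textbook computation in Jensen's proof. -/

namespace RhW08.Lens1

open Complex
open scoped ComplexConjugate

/-- `Im (1/w) = −Im w / |w|²` (convenience form with `normSq` expanded). -/
private theorem inv_im_eq (w : ℂ) : (w⁻¹).im = -w.im / (w.re ^ 2 + w.im ^ 2) := by
  rw [inv_im, normSq_apply]; ring

/-- **PAIR TERM SIGN**: the conjugate pair `{c, c̄}` pushes the field at `v` UPWARD iff `v` lies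
STRICTLY INSIDE the pair's Jensen disc `D(Re c, |Im c|)` — i.e. iff `c` is a ROOF over `v`. -/
theorem pairField_im_pos_iff {v c : ℂ} (hv : 0 < v.im) (hc : c.im ≠ 0) (h1 : c ≠ v) (h2 : c ≠ conj v) :
    0 < ((v - c)⁻¹ + (v - conj c)⁻¹).im ↔ (v.re - c.re) ^ 2 + v.im ^ 2 < c.im ^ 2 := by
  -- Set up notation
  set u := v.re - c.re with hu_def
  set Y := v.im with hY_def
  set y := c.im with hy_def
  have hY : 0 < Y := hv
  have hyne : y ≠ 0 := hc
  have hne1 : v - c ≠ 0 := sub_ne_zero.mpr h1.symm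
  have h2' : conj c ≠ v := by
    intro heq
    apply h2
    rw [← heq, conj_conj]
  have hne2 : v - conj c ≠ 0 := sub_ne_zero.mpr h2'.symm
  -- Express v - c and v - conj c
  have hvc_re : (v - c).re = u := by simp [hu_def]
  have hvc_im : (v - c).im = Y - y := by simp [hY_def, hy_def]
  have hvcc_re : (v - conj c).re = u := by simp [hu_def]
  have hvcc_im : (v - conj c).im = Y + y := by simp [hY_def, hy_def]
  -- Apply inv_im_eq to each term
  have inv1 : (v - c)⁻¹.im = -(Y - y) / (u ^ 2 + (Y - y) ^ 2) := by
    rw [inv_im_eq, hvc_re, hvc_im]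
  have inv2 : (v - conj c)⁻¹.im = -(Y + y) / (u ^ 2 + (Y + y) ^ 2) := by
    rw [inv_im_eq, hvcc_re, hvcc_im]
  -- The sum
  rw [add_im, inv1, inv2]
  -- Denominators are positive
  have hn1 : 0 < u ^ 2 + (Y - y) ^ 2 := by
    have hns : normSq (v - c) = u ^ 2 + (Y - y) ^ 2 := by
      rw [normSq_apply, hvc_re, hvc_im]; ring
    rw [← hns]; exact normSq_pos.mpr hne1
  have hn2 : 0 < u ^ 2 + (Y + y) ^ 2 := by
    have hns : normSq (v - conj c) = u ^ 2 + (Y + y) ^ 2 := by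
      rw [normSq_apply, hvcc_re, hvcc_im]; ring
    rw [← hns]; exact normSq_pos.mpr hne2
  -- Key algebraic identity (from DeBruijnHLogDerivSeries.pair_im_le proof)
  have key : -(Y - y) / (u ^ 2 + (Y - y) ^ 2) + -(Y + y) / (u ^ 2 + (Y + y) ^ 2) =
      (-2 * Y * (u ^ 2 + Y ^ 2 - y ^ 2)) / ((u ^ 2 + (Y - y) ^ 2) * (u ^ 2 + (Y + y) ^ 2)) := by
    field_simp
    ring
  rw [key]
  have hprod : 0 < (u ^ 2 + (Y - y) ^ 2) * (u ^ 2 + (Y + y) ^ 2) := mul_pos hn1 hn2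
  -- The sign of the fraction is determined by the numerator
  rw [div_pos_iff]
  constructor
  · intro hpos
    rcases hpos with ⟨hnum, _⟩ | ⟨_, hdenom⟩
    · -- Numerator positive: -2Y(u² + Y² - y²) > 0
      -- Since Y > 0, this means u² + Y² - y² < 0
      nlinarith
    · -- Denominator negative: impossible since hprod > 0
      linarith
  · intro hlt
    left
    constructor
    · -- Need: -2Y(u² + Y² - y²) > 0
      -- Since hlt says u² + Y² < y², we have u² + Y² - y² < 0
      -- And Y > 0, so -2Y(u² + Y² - y²) > 0
      nlinarith
    · exact hprod

end RhW08.Lens1
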